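import Summits.KontsevichZagierPeriods.KontsevichZagierPeriods.Theses.TerasomaMultiplication
import Summits.KontsevichZagierPeriods.KontsevichZagierPeriods.Theorems.TerasomaMultiplicationMultiplicationAccessibleCornerStokesYAux
import Literature.NumberTheory.Transcendental.KZHomotopyMoves
import Literature.NumberTheory.Transcendental.SemialgebraicRpow
import Literature.NumberTheory.Transcendental.SemialgebraicLineDeriv
import Literature.NumberTheory.Transcendental.KZLogCalculusProofs
import Literature.NumberTheory.Transcendental.KZProductIdeal

/-!
# `MultiplicationAccessible` (stmt-KontsevichZagierPeriods-12305), line `shifted-family-prime-sieve`: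
the `y`-direction Newton–Leibniz move of the corner Stokes at `p = 3` (exceptional face)

Registered sub-goal `cornerStokesY` of the crux `stub_gmThreeShifted` (Liouville rotation flow /
corner Stokes).  In the coordinates `w = (θ₁, θ₂, y, v)` of the chart domain `W` the component
`c₂` of the closed 3-form is, on each `y`-fibre `(0, 1/θ_max)` over the base
`B_y = {(θ₁, θ₂, v) | θ's > 0, θ₁ + θ₂ < 1, 0 < v < 1}`, a function continuous on the CLOSED fibre
with the value of the Dirichlet face density at `y = 0` and the value `0` at `y = 1/θ_max`.  One
rule-3 move in `y` (band over `B_y`, `KZ.exists_band_newtonLeibniz`, after moving `y` to the last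
slot by the coordinate swap `(2 3)`, a rule-2 move `KZ.of_sub_of_reindex_mem_relations`) therefore
gives `[W, ∂_y c₂] + [B_y, face] ∈ KZ.relations`.  The fibrewise derivative and its bound come from
`cornerStokesYAux`, the fibre values and continuity from `CornerY.fibre_zero/top/continuousOn`.

References: M. Kontsevich, D. Zagier, *Periods* (2001), §1.2 rules (2), (3); G. Andrews, R. Askey,
R. Roy, *Special Functions* (1999), §1.8.
-/

noncomputable section

open MeasureTheory Set Real
open scoped Topology
open Literature.NumberTheory.Transcendental
open Literature.NumberTheory.Transcendental.KZ
open Literature.ModelTheory.ExponentialFields (IsSemialgebraic isSemialgebraic_setOf_eval_pos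
  isSemialgebraic_setOf_eval_lt)
open MvPolynomial (aeval X C)

namespace Summit.KontsevichZagierPeriods.TerasomaMultiplication.MultiplicationAccessible

namespace CornerY

/-- The base `B_y` of the `y`-move is `ℚ`-semialgebraic. [folklore] -/
theorem isSemialgebraic_By :
    IsSemialgebraic ℚ {q : Fin 3 → ℝ | 0 < q 0 ∧ 0 < q 1 ∧ q 0 + q 1 < 1 ∧ 0 < q 2 ∧ q 2 < 1} := by
  have h0 := isSemialgebraic_setOf_eval_pos (k := ℚ) (R := ℝ) (X 0 : MvPolynomial (Fin 3) ℚ)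
  have h1 := isSemialgebraic_setOf_eval_pos (k := ℚ) (R := ℝ) (X 1 : MvPolynomial (Fin 3) ℚ)
  have h2 := isSemialgebraic_setOf_eval_lt (k := ℚ) (R := ℝ) (X 0 + X 1 : MvPolynomial (Fin 3) ℚ) 1
  have h3 := isSemialgebraic_setOf_eval_pos (k := ℚ) (R := ℝ) (X 2 : MvPolynomial (Fin 3) ℚ)
  have h4 := isSemialgebraic_setOf_eval_lt (k := ℚ) (R := ℝ) (X 2 : MvPolynomial (Fin 3) ℚ) 1
  convert ((((h0.inter h1).inter h2).inter h3).inter h4) using 1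
  ext q
  simp only [map_add, map_one, MvPolynomial.aeval_X, mem_setOf_eq, mem_inter_iff]
  tauto

/-- The upper fibre bound `b = min (1/θ₀, 1/θ₁, 1/θ₂)` is `ℚ`-semialgebraic on `B_y`. [folklore] -/
theorem isSemialgebraicFunOn_b :
    IsSemialgebraicFunOn ℚ {q : Fin 3 → ℝ | 0 < q 0 ∧ 0 < q 1 ∧ q 0 + q 1 < 1 ∧ 0 < q 2 ∧ q 2 < 1}
      (fun q => min (min (1 / (1 - q 0 - q 1)) (1 / q 0)) (1 / q 1)) := by
  set By : Set (Fin 3 → ℝ) := {q : Fin 3 → ℝ | 0 < q 0 ∧ 0 < q 1 ∧ q 0 + q 1 < 1 ∧ 0 < q 2 ∧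
    q 2 < 1} with hBy
  have hB : IsSemialgebraic ℚ By := isSemialgebraic_By
  have one : IsSemialgebraicFunOn ℚ By (fun _ : Fin 3 → ℝ => (1:ℝ)) :=
    isSemialgebraicFunOn_const_of_isAlgebraic hB isAlgebraic_one
  have c0 := isSemialgebraicFunOn_apply hB 0
  have c1 := isSemialgebraicFunOn_apply hB 1
  have i0 := one.div ((one.fun_sub c0).fun_sub c1) fun q hq => by
    have h := hq.2.2.1; linarith
  have i1 := one.div c0 fun q hq => ne_of_gt hq.1
  have i2 := one.div c1 fun q hq => ne_of_gt hq.2.1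
  have hm : ∀ {f g : (Fin 3 → ℝ) → ℝ}, IsSemialgebraicFunOn ℚ By f → IsSemialgebraicFunOn ℚ By g →
      IsSemialgebraicFunOn ℚ By (fun q => min (f q) (g q)) := by
    intro f g hf hg
    have h2 : IsSemialgebraicFunOn ℚ By (fun _ : Fin 3 → ℝ => (2:ℝ)) := by
      simpa using isSemialgebraicFunOn_ratCast hB 2
    exact (((hf.fun_add hg).fun_sub (hf.fun_sub hg).abs).div h2 fun _ _ => two_ne_zero).congr
      fun q _ => (min_eq_half _ _).symm
  exact hm (hm i0 i1) i2

/-- Values of the coordinate swap `(2 3)` of `Fin 4`. [folklore] -/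
theorem swap_apply_vals : (Equiv.swap (2 : Fin 4) 3) 0 = 0 ∧ (Equiv.swap (2 : Fin 4) 3) 1 = 1 ∧
    (Equiv.swap (2 : Fin 4) 3) 2 = 3 ∧ (Equiv.swap (2 : Fin 4) 3) 3 = 2 ∧
    (Equiv.swap (2 : Fin 4) 3) (Fin.last 3) = 2 := by decide

/-- Values of `Fin.snoc q t` on `Fin 4`. [folklore] -/
theorem snoc_apply_vals (q : Fin 3 → ℝ) (t : ℝ) : (Fin.snoc q t : Fin 4 → ℝ) 0 = q 0 ∧
    (Fin.snoc q t : Fin 4 → ℝ) 1 = q 1 ∧ (Fin.snoc q t : Fin 4 → ℝ) 2 = q 2 ∧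
    (Fin.snoc q t : Fin 4 → ℝ) 3 = t := ⟨rfl, rfl, rfl, rfl⟩

/-- The band of the `y`-move has finite volume (it lies in `[0,3]⁴`). [folklore] -/
theorem volume_bandY_lt_top :
    volume (KZlog.band {q : Fin 3 → ℝ | 0 < q 0 ∧ 0 < q 1 ∧ q 0 + q 1 < 1 ∧ 0 < q 2 ∧ q 2 < 1}
      (fun _ => 0) (fun q => min (min (1 / (1 - q 0 - q 1)) (1 / q 0)) (1 / q 1))) < ⊤ := by
  refine lt_of_le_of_lt (measure_mono fun w' hw' => ?_)
    (measure_Icc_lt_top (a := (0 : Fin 4 → ℝ)) (b := 3))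
  obtain ⟨⟨h0, h1, h01, hv0, hv1⟩, hy, hyb⟩ :
    (0 < w' 0 ∧ 0 < w' 1 ∧ w' 0 + w' 1 < 1 ∧ 0 < w' 2 ∧ w' 2 < 1) ∧ 0 ≤ w' 3 ∧
      w' 3 ≤ min (min (1 / (1 - w' 0 - w' 1)) (1 / w' 0)) (1 / w' 1) := hw'
  obtain ⟨-, -, -, -, -, b3⟩ := b_props (θ₀ := 1 - w' 0 - w' 1) (by linarith) h0 h1 (by ring)
  have hy3 : w' 3 ≤ 3 := hyb.trans b3
  refine ⟨fun i => ?_, fun i => ?_⟩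
  · fin_cases i <;> simp <;> linarith
  · fin_cases i <;> simp <;> linarith

end CornerY

/-- **The `y`-direction Newton–Leibniz move of the corner Stokes** (registered sub-goal
`cornerStokesY` of `stub_gmThreeShifted`): the band representation `N = [W, ∂_y c₂]` exists and
`[N] + [R] ∈ KZ.relations` for the exceptional-face representation `R = [B_y, face]`.  With `y`
moved to the last slot, rule (3) over `B_y` with fibres `[0, 1/θ_max]` and primitive `c₂` gives
`[band, ∂_y c₂] ∼ [B_y, c₂(·, 1/θ_max) − c₂(·, 0)] = [B_y, 0 − face] = −[R]`; then the fibres are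
opened (a null set) and the coordinates swapped back (rule (2)).
[cite: KontsevichZagier2001, §1.2 rule (3)] -/
theorem cornerStokesY : ∀ (x s : ℚ), 2 ≤ x → 3 ≤ s → ∀ (Z S H K M0 M1 M2 P : (Fin 4 → ℝ) → ℝ),
    (∀ w, Z w = ((1 - w 2 * (1 - w 0 - w 1)) * (1 - w 2 * w 0) * (1 - w 2 * w 1)) ^ ((1:ℝ)/3)) →
    (∀ w, S w = 1 - w 2 * ((1 - w 0 - w 1) * w 0 + (1 - w 0 - w 1) * w 1 + w 0 * w 1) +
      (w 2) ^ 2 * ((1 - w 0 - w 1) * w 0 * w 1)) →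
    (∀ w, H w = (1 + Z w + Z w ^ 2) / S w) →
    (∀ w, K w = ((1 - w 0 - w 1) * w 0 * w 1) ^ ((s:ℝ) - 1)) →
    (∀ w, M0 w = (1 - w 2 * (1 - w 0 - w 1)) ^ (x:ℝ) * (1 - w 2 * w 0) ^ ((x:ℝ) - 2/3) * (1 - w 2 * w 1) ^ ((x:ℝ) - 1/3)) →
    (∀ w, M1 w = (1 - w 2 * (1 - w 0 - w 1)) ^ ((x:ℝ) - 1/3) * (1 - w 2 * w 0) ^ (x:ℝ) * (1 - w 2 * w 1) ^ ((x:ℝ) - 2/3)) →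
    (∀ w, M2 w = (1 - w 2 * (1 - w 0 - w 1)) ^ ((x:ℝ) - 2/3) * (1 - w 2 * w 0) ^ ((x:ℝ) - 1/3) * (1 - w 2 * w 1) ^ (x:ℝ)) →
    (∀ w, P w = (w 3) ^ (3 * (x:ℝ) - 1) * (1 - w 3 * Z w) ^ (3 * (s:ℝ) - 1) * H w ^ (3 * (s:ℝ)) * K w) →
    ∀ (c2 : (Fin 4 → ℝ) → ℝ), (∀ w, c2 w = P w * ((1 - w 0 - w 1) * M0 w + w 0 * M1 w + w 1 * M2 w)) →
    ∀ (R : KZ.IntegralRep 3), R.domain = {q : Fin 3 → ℝ | 0 < q 0 ∧ 0 < q 1 ∧ q 0 + q 1 < 1 ∧ 0 < q 2 ∧ q 2 < 1} →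
    Set.EqOn R.integrand (fun q => (3 * (q 2) ^ (3 * (x:ℝ) - 1) * (1 - q 2) ^ (3 * (s:ℝ) - 1)) *
      ((3:ℝ) ^ (3 * (s:ℝ) - 1) * ((1 - q 0 - q 1) * q 0 * q 1) ^ ((s:ℝ) - 1))) R.domain →
    ∃ N : KZ.IntegralRep 4, N.domain = {w : Fin 4 → ℝ | 0 < w 0 ∧ 0 < w 1 ∧ w 0 + w 1 < 1 ∧ 0 < w 2 ∧ w 2 * (1 - w 0 - w 1) < 1 ∧ w 2 * w 0 < 1 ∧ w 2 * w 1 < 1 ∧ 0 < w 3 ∧ w 3 < 1} ∧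
      (∀ w ∈ N.domain, HasDerivAt (fun a => c2 (Function.update w 2 a)) (N.integrand w) (w 2)) ∧
      KZ.of N + KZ.of R ∈ KZ.relations := by
  intro x s hx hs Z S H K M0 M1 M2 P hZ hS hH hK hM0 hM1 hM2 hP c2 hc2 R hRd hRi
  obtain ⟨d, hdsa, ⟨C, hC⟩, hder⟩ :=
    cornerStokesYAux x s hx hs Z S H K M0 M1 M2 P hZ hS hH hK hM0 hM1 hM2 hP c2 hc2
  have hxR : (2:ℝ) ≤ x := by exact_mod_cast hx
  have hsR : (3:ℝ) ≤ s := by exact_mod_cast hs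
  obtain ⟨sw0, sw1, sw2, sw3, swl⟩ := CornerY.swap_apply_vals
  -- the sets and maps
  set W : Set (Fin 4 → ℝ) := {w : Fin 4 → ℝ | 0 < w 0 ∧ 0 < w 1 ∧ w 0 + w 1 < 1 ∧ 0 < w 2 ∧
    w 2 * (1 - w 0 - w 1) < 1 ∧ w 2 * w 0 < 1 ∧ w 2 * w 1 < 1 ∧ 0 < w 3 ∧ w 3 < 1} with hW
  set By : Set (Fin 3 → ℝ) := {q : Fin 3 → ℝ | 0 < q 0 ∧ 0 < q 1 ∧ q 0 + q 1 < 1 ∧ 0 < q 2 ∧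
    q 2 < 1} with hBy
  set b : (Fin 3 → ℝ) → ℝ := fun q => min (min (1 / (1 - q 0 - q 1)) (1 / q 0)) (1 / q 1) with hb
  set e : Fin 4 ≃ Fin 4 := Equiv.swap (2 : Fin 4) 3 with he
  set σ : (Fin 4 → ℝ) → (Fin 4 → ℝ) := fun w i => w (e i) with hσ
  have hσσ : ∀ w, σ (σ w) = w := fun w => by ext i; simp [σ, e, Equiv.swap_apply_self]
  have hσ0 : ∀ w, σ w 0 = w 0 := fun w => by simp [σ, sw0]
  have hσ1 : ∀ w, σ w 1 = w 1 := fun w => by simp [σ, sw1]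
  have hσ2 : ∀ w, σ w 2 = w 3 := fun w => by simp [σ, sw2]
  have hσ3 : ∀ w, σ w 3 = w 2 := fun w => by simp [σ, sw3]
  set Bd : Set (Fin 4 → ℝ) := KZlog.band By (fun _ => (0:ℝ)) b with hBd
  have hBysa : IsSemialgebraic ℚ By := CornerY.isSemialgebraic_By
  have hBymeas : MeasurableSet By :=
    Literature.ModelTheory.ExponentialFields.IsSemialgebraic.measurableSet_holds hBysa
  have hasa : IsSemialgebraicFunOn ℚ By (fun _ : Fin 3 → ℝ => (0:ℝ)) := by
    simpa using isSemialgebraicFunOn_ratCast hBysa 0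
  have hbsa : IsSemialgebraicFunOn ℚ By b := CornerY.isSemialgebraicFunOn_b
  have hBdsa : IsSemialgebraic ℚ Bd := KZlog.isSemialgebraic_band hasa hbsa
  have hBdmeas : MeasurableSet Bd :=
    Literature.ModelTheory.ExponentialFields.IsSemialgebraic.measurableSet_holds hBdsa
  have hWsa : IsSemialgebraic ℚ W := CornerTheta1.isSemialgebraic_W
  -- membership unfoldings
  have hmemBd : ∀ w', w' ∈ Bd ↔ ((0 < w' 0 ∧ 0 < w' 1 ∧ w' 0 + w' 1 < 1 ∧ 0 < w' 2 ∧ w' 2 < 1) ∧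
      0 ≤ w' 3 ∧ w' 3 ≤ min (min (1 / (1 - w' 0 - w' 1)) (1 / w' 0)) (1 / w' 1)) := fun w' => Iff.rfl
  have hmemA : ∀ w, σ w ∈ Bd ↔ ((0 < w 0 ∧ 0 < w 1 ∧ w 0 + w 1 < 1 ∧ 0 < w 3 ∧ w 3 < 1) ∧
      0 ≤ w 2 ∧ w 2 ≤ min (min (1 / (1 - w 0 - w 1)) (1 / w 0)) (1 / w 1)) := fun w => Iff.rfl
  have hbq : ∀ {q : Fin 3 → ℝ}, q ∈ By → 0 < b q ∧ b q * (1 - q 0 - q 1) ≤ 1 ∧ b q * q 0 ≤ 1 ∧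
      b q * q 1 ≤ 1 ∧ (b q * (1 - q 0 - q 1) = 1 ∨ b q * q 0 = 1 ∨ b q * q 1 = 1) ∧ b q ≤ 3 :=
    fun {q} hq => CornerY.b_props (θ₀ := 1 - q 0 - q 1) (by linarith only [hq.1, hq.2.1, hq.2.2.1])
      hq.1 hq.2.1 (by ring)
  -- the open band is the swapped chart domain
  set W' : Set (Fin 4 → ℝ) := {w' | σ w' ∈ W} with hW'
  have hW'sa : IsSemialgebraic ℚ W' := hWsa.preimage_comp e
  have hW'sub : W' ⊆ Bd := by
    intro w' hw'
    obtain ⟨h0, h1, h01, hy, hy0, hy1, hy2, hv0, hv1⟩ := hw'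
    rw [hσ0] at h0; rw [hσ1] at h1; rw [hσ0, hσ1] at h01; rw [hσ2] at hy hy0 hy1 hy2
    rw [hσ0, hσ1] at hy0; rw [hσ0] at hy1; rw [hσ1] at hy2; rw [hσ3] at hv0 hv1
    exact (hmemBd w').2 ⟨⟨h0, h1, h01, hv0, hv1⟩, hy.le,
      CornerY.le_b_of_lt (by linarith only [h0, h1, h01]) h0 h1 hy0 hy1 hy2⟩
  -- the primitive `F = c₂ ∘ σ` and the band integrand `f`
  set F : (Fin 4 → ℝ) → ℝ := fun w' => c2 (σ w') with hF
  set f : (Fin 4 → ℝ) → ℝ := W'.indicator fun w' => d (σ w') with hf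
  -- semialgebraicity of `F` on the closed band (through `c₂` on the swapped band)
  have hAsa : IsSemialgebraic ℚ {w | σ w ∈ Bd} := hBdsa.preimage_comp e
  have hc2A : IsSemialgebraicFunOn ℚ {w | σ w ∈ Bd} c2 := by
    refine CornerY.isSemialgebraicFunOn_c2 hx hs hZ hS hH hK hM0 hM1 hM2 hP hc2 hAsa fun w hw => ?_
    obtain ⟨⟨h0, h1, h01, hv0, hv1⟩, hy, hyb⟩ := (hmemA w).1 hw
    have hθ₀ : 0 < 1 - w 0 - w 1 := by linarith only [h0, h1, h01]
    obtain ⟨⟨ht0, ht1, ht2⟩, hp0, hp1⟩ := CornerY.box_nonneg hθ₀ h0 h1 hy hyb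
    have hZ0 : 0 ≤ Z w := by rw [hZ]; positivity
    have hZ1 : Z w ≤ 1 := by rw [hZ]; exact rpow_le_one hp0 hp1 (by norm_num)
    have hS3 : 1 / 3 ≤ S w := by
      rw [hS]
      exact CornerY.third_le_S (θ₀ := 1 - w 0 - w 1) (by ring) hθ₀.le h0.le h1.le hy ht0 ht1 ht2
    have hS0 : 0 < S w := lt_of_lt_of_le (by norm_num) hS3
    have hvZ : 0 ≤ 1 - w 3 * Z w := by
      have := mul_le_mul_of_nonneg_left hZ1 hv0.le; linarith only [this, hv1]
    refine ⟨⟨ht0, ht1, ht2⟩, hS0.ne', ?_, hv0.le, hvZ, by positivity⟩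
    rw [hH]; positivity
  have hσmap : ∀ {T : Set (Fin 4 → ℝ)}, IsSemialgebraic ℚ T → IsSemialgebraicMapOn ℚ T σ :=
    fun hT => IsSemialgebraicMapOn.of_forall hT fun j => isSemialgebraicFunOn_apply hT (e j)
  have hFsa : IsSemialgebraicFunOn ℚ Bd F :=
    IsSemialgebraicFunOn.comp_isSemialgebraicMapOn_holds hc2A (hσmap hBdsa) fun w' hw' => by
      show σ (σ w') ∈ Bd; rw [hσσ]; exact hw'
  have hfsa : IsSemialgebraicFunOn ℚ Bd f := by
    rw [← union_sdiff_cancel hW'sub]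
    refine IsSemialgebraicFunOn.union (IsSemialgebraicFunOn.comp_isSemialgebraicMapOn_holds hdsa
      (hσmap hW'sa) fun w' hw' => hw') ((isSemialgebraicFunOn_ratCast (hBdsa.diff hW'sa) 0).congr
      fun _ _ => by push_cast; rfl) (fun w' hw' => indicator_of_mem hw' _)
      fun w' hw' => indicator_of_notMem hw'.2 _
  -- the one-variable fibre data over a base point
  have hfib : ∀ q ∈ By, ∀ a : ℝ, σ (Fin.snoc q a) 0 = q 0 ∧ σ (Fin.snoc q a) 1 = q 1 ∧
      σ (Fin.snoc q a) 2 = a ∧ σ (Fin.snoc q a) 3 = q 2 := fun q _ a => by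
    obtain ⟨s0, s1, s2, s3⟩ := CornerY.snoc_apply_vals q a
    exact ⟨by rw [hσ0, s0], by rw [hσ1, s1], by rw [hσ2, s3], by rw [hσ3, s2]⟩
  have hZf : ∀ q ∈ By, ∀ a, Z (σ (Fin.snoc q a)) =
      ((1 - a * (1 - q 0 - q 1)) * (1 - a * q 0) * (1 - a * q 1)) ^ ((1:ℝ) / 3) := fun q hq a => by
    obtain ⟨e0, e1, e2, e3⟩ := hfib q hq a; rw [hZ, e0, e1, e2]
  have hSf : ∀ q ∈ By, ∀ a, S (σ (Fin.snoc q a)) =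
      1 - a * ((1 - q 0 - q 1) * q 0 + (1 - q 0 - q 1) * q 1 + q 0 * q 1) +
        a ^ 2 * ((1 - q 0 - q 1) * q 0 * q 1) := fun q hq a => by
    obtain ⟨e0, e1, e2, e3⟩ := hfib q hq a; rw [hS, e0, e1, e2]
  have hM0f : ∀ q ∈ By, ∀ a, M0 (σ (Fin.snoc q a)) = (1 - a * (1 - q 0 - q 1)) ^ (x:ℝ) *
      (1 - a * q 0) ^ ((x:ℝ) - 2 / 3) * (1 - a * q 1) ^ ((x:ℝ) - 1 / 3) := fun q hq a => by
    obtain ⟨e0, e1, e2, e3⟩ := hfib q hq a; rw [hM0, e0, e1, e2]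
  have hM1f : ∀ q ∈ By, ∀ a, M1 (σ (Fin.snoc q a)) = (1 - a * (1 - q 0 - q 1)) ^ ((x:ℝ) - 1 / 3) *
      (1 - a * q 0) ^ (x:ℝ) * (1 - a * q 1) ^ ((x:ℝ) - 2 / 3) := fun q hq a => by
    obtain ⟨e0, e1, e2, e3⟩ := hfib q hq a; rw [hM1, e0, e1, e2]
  have hM2f : ∀ q ∈ By, ∀ a, M2 (σ (Fin.snoc q a)) = (1 - a * (1 - q 0 - q 1)) ^ ((x:ℝ) - 2 / 3) *
      (1 - a * q 0) ^ ((x:ℝ) - 1 / 3) * (1 - a * q 1) ^ (x:ℝ) := fun q hq a => by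
    obtain ⟨e0, e1, e2, e3⟩ := hfib q hq a; rw [hM2, e0, e1, e2]
  have hFf : ∀ q ∈ By, ∀ a, F (Fin.snoc q a) = (q 2) ^ (3 * (x:ℝ) - 1) *
      (1 - q 2 * Z (σ (Fin.snoc q a))) ^ (3 * (s:ℝ) - 1) *
      ((1 + Z (σ (Fin.snoc q a)) + Z (σ (Fin.snoc q a)) ^ 2) / S (σ (Fin.snoc q a))) ^ (3 * (s:ℝ)) *
      ((1 - q 0 - q 1) * q 0 * q 1) ^ ((s:ℝ) - 1) *
      ((1 - q 0 - q 1) * M0 (σ (Fin.snoc q a)) + q 0 * M1 (σ (Fin.snoc q a)) +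
        q 1 * M2 (σ (Fin.snoc q a))) := fun q hq a => by
    obtain ⟨e0, e1, e2, e3⟩ := hfib q hq a
    simp only [hF, hc2, hP, hH, hK, e0, e1, e3]
  -- continuity on the closed fibres, the end values, the derivative on the open fibres
  have hcont : ∀ q ∈ By, ContinuousOn (fun t : ℝ => F (Fin.snoc q t)) (Icc ((fun _ => (0:ℝ)) q) (b q)) := by
    intro q hq
    obtain ⟨-, b0, b1, b2, -, -⟩ := hbq hq
    exact CornerY.fibre_continuousOn hxR hsR (θ₀ := 1 - q 0 - q 1)
      (by linarith only [hq.1, hq.2.1, hq.2.2.1]) hq.1.le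
      hq.2.1.le (by ring) b0 b1 b2 (fun a => Z (σ (Fin.snoc q a))) (fun a => S (σ (Fin.snoc q a)))
      (fun a => M0 (σ (Fin.snoc q a))) (fun a => M1 (σ (Fin.snoc q a)))
      (fun a => M2 (σ (Fin.snoc q a))) (fun t => F (Fin.snoc q t)) (hZf q hq) (hSf q hq) (hM0f q hq)
      (hM1f q hq) (hM2f q hq) (hFf q hq)
  have htop : ∀ q ∈ By, F (Fin.snoc q (b q)) = 0 := by
    intro q hq
    obtain ⟨-, -, -, -, hor, -⟩ := hbq hq
    exact CornerY.fibre_top hxR hor (fun a => Z (σ (Fin.snoc q a))) (fun a => S (σ (Fin.snoc q a)))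
      (fun a => M0 (σ (Fin.snoc q a))) (fun a => M1 (σ (Fin.snoc q a)))
      (fun a => M2 (σ (Fin.snoc q a))) (fun t => F (Fin.snoc q t)) (hM0f q hq) (hM1f q hq) (hM2f q hq)
      (hFf q hq)
  have hzero : ∀ q ∈ By, F (Fin.snoc q 0) = R.integrand q := by
    intro q hq
    have h := CornerY.fibre_zero (x := (x:ℝ)) (s := (s:ℝ)) (v := q 2) (θ₀ := 1 - q 0 - q 1)
      (θ₁ := q 0) (θ₂ := q 1) (by ring) (fun a => Z (σ (Fin.snoc q a))) (fun a => S (σ (Fin.snoc q a)))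
      (fun a => M0 (σ (Fin.snoc q a))) (fun a => M1 (σ (Fin.snoc q a)))
      (fun a => M2 (σ (Fin.snoc q a))) (fun t => F (Fin.snoc q t)) (hZf q hq) (hSf q hq) (hM0f q hq)
      (hM1f q hq) (hM2f q hq) (hFf q hq)
    rw [hRi (by rw [hRd]; exact hq), h,
      Real.rpow_sub_one (by norm_num : (3:ℝ) ≠ 0) (3 * (s:ℝ))]
    ring
  have hbdry : ∀ q ∈ By, F (Fin.snoc q (b q)) - F (Fin.snoc q ((fun _ => (0:ℝ)) q)) = -R.integrand q :=
    fun q hq => by simp only [htop q hq, hzero q hq]; ring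
  have hder' : ∀ q ∈ By, ∀ t ∈ Ioo ((fun _ : Fin 3 → ℝ => (0:ℝ)) q) (b q),
      HasDerivAt (fun t : ℝ => F (Fin.snoc q t)) (f (Fin.snoc q t)) t := by
    intro q hq t ht
    obtain ⟨h0, h1, h01, hv0, hv1⟩ := hq
    obtain ⟨ht0, htb⟩ := ht
    obtain ⟨a01, a2⟩ := lt_min_iff.mp htb
    obtain ⟨a0, a1⟩ := lt_min_iff.mp a01
    have hw : σ (Fin.snoc q t) ∈ W := by
      obtain ⟨e0, e1, e2, e3⟩ := hfib q ⟨h0, h1, h01, hv0, hv1⟩ t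
      refine ⟨?_, ?_, ?_, ?_, ?_, ?_, ?_, ?_, ?_⟩ <;> simp only [e0, e1, e2, e3]
      · exact h0
      · exact h1
      · exact h01
      · exact ht0
      · exact (lt_div_iff₀ (by linarith only [h0, h1, h01])).mp a0
      · exact (lt_div_iff₀ h0).mp a1
      · exact (lt_div_iff₀ h1).mp a2
      · exact hv0
      · exact hv1
    have hpath : ∀ a, σ (Fin.snoc q a) = Function.update (σ (Fin.snoc q t)) 2 a := by
      intro a
      obtain ⟨e0, e1, e2, e3⟩ := hfib q ⟨h0, h1, h01, hv0, hv1⟩ a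
      obtain ⟨f0, f1, f2, f3⟩ := hfib q ⟨h0, h1, h01, hv0, hv1⟩ t
      ext i
      fin_cases i
      · simp [e0, f0]
      · simp [e1, f1]
      · simp [e2]
      · simp [e3, f3]
    have hft : f (Fin.snoc q t) = d (σ (Fin.snoc q t)) := indicator_of_mem (show _ ∈ W' from hw) _
    rw [hft]
    have hfun : (fun a : ℝ => F (Fin.snoc q a)) = fun a => c2 (Function.update (σ (Fin.snoc q t)) 2 a) :=
      funext fun a => by simp only [hF, hpath a]
    rw [hfun]
    have h := hder _ hw
    rwa [(hfib q ⟨h0, h1, h01, hv0, hv1⟩ t).2.2.1] at h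
  -- integrability of the band integrand: bounded, measurable, band of finite volume
  have hvol : volume Bd < ⊤ := CornerY.volume_bandY_lt_top
  have hint : IntegrableOn f Bd := by
    refine ⟨aestronglyMeasurable_of_isSemialgebraicFunOn hfsa hBdmeas,
      HasFiniteIntegral.restrict_of_bounded (C := |C|) hvol ((ae_restrict_mem hBdmeas).mono
        fun w' _ => ?_)⟩
    rw [Real.norm_eq_abs]
    by_cases hw' : w' ∈ W'
    · rw [hf, indicator_of_mem hw']; exact (hC _ hw').trans (le_abs_self C)
    · rw [hf, indicator_of_notMem hw', abs_zero]; exact abs_nonneg C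
  -- the boundary data
  have hRsa : IsSemialgebraicFunOn ℚ By R.integrand := by
    have h := R.isSemialgebraicFunOn_integrand; rwa [hRd] at h
  have hRint : IntegrableOn R.integrand By := by have h := R.integrableOn; rwa [hRd] at h
  have hds : IsSemialgebraicFunOn ℚ By (fun q => F (Fin.snoc q (b q)) - F (Fin.snoc q ((fun _ => (0:ℝ)) q))) :=
    hRsa.neg.congr fun q hq => by rw [Pi.neg_apply, hbdry q hq]
  have hdi : IntegrableOn (fun q => F (Fin.snoc q (b q)) - F (Fin.snoc q ((fun _ => (0:ℝ)) q))) By :=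
    hRint.neg.congr_fun (fun q hq => by rw [Pi.neg_apply, hbdry q hq]) hBymeas
  -- rule (3), opening the fibres, swapping back
  obtain ⟨rb, rd, hrbd, hrbi, hrdd, hrdi, hrel⟩ :=
    KZ.exists_band_newtonLeibniz hBysa (fun _ => (0:ℝ)) b hasa hbsa (fun q hq => (hbq hq).1.le)
      F f hFsa hfsa hcont hder' hint hds hdi
  obtain ⟨r', hr'd, hr'i, hr'rel⟩ := KZ.of_sub_of_restrict_openBand_mem_relations hasa hbsa rb hrbd
  have hNd : (r'.reindex e).domain = W := by
    ext w
    rw [IntegralRep.reindex_domain, mem_setOf_eq, hr'd, mem_setOf_eq]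
    exact CornerY.mem_W_iff w
  refine ⟨r'.reindex e, hNd, fun w hw => ?_, ?_⟩
  · rw [hNd] at hw
    rw [IntegralRep.reindex_integrand, hr'i, hrbi]
    have hmem : σ w ∈ W' := by show σ (σ w) ∈ W; rw [hσσ]; exact hw
    show HasDerivAt (fun a => c2 (Function.update w 2 a)) (f (σ w)) (w 2)
    rw [hf, indicator_of_mem hmem, hσσ]
    exact hder w hw
  · -- `[rd] + [R] ∼ 0` (the boundary integrand is `-face`)
    have hsa : IsSemialgebraicFunOn ℚ By (fun q => rd.integrand q + R.integrand q) := by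
      have h := rd.isSemialgebraicFunOn_integrand; rw [hrdd] at h; exact h.fun_add hRsa
    have hin : IntegrableOn (fun q => rd.integrand q + R.integrand q) By := by
      have h := rd.integrableOn; rw [hrdd] at h; exact h.add hRint
    let r0 : KZ.IntegralRep 3 := ⟨By, fun q => rd.integrand q + R.integrand q, hBysa, hsa, hin⟩
    have h0 : KZ.of r0 ∈ KZ.relations := KZ.of_mem_relations_of_eqOn_zero r0 fun q hq => by
      show rd.integrand q + R.integrand q = 0
      rw [hrdi]
      show F (Fin.snoc q (b q)) - F (Fin.snoc q ((fun _ => (0:ℝ)) q)) + R.integrand q = 0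
      rw [hbdry q hq]; ring
    have h1 : KZ.of r0 - KZ.of rd - KZ.of R ∈ KZ.relations :=
      KZ.integrandAddRel_subset_relations ⟨3, r0, rd, R, hrdd, hRd, fun q _ => rfl, rfl⟩
    have hrdR : KZ.of rd + KZ.of R ∈ KZ.relations := by
      have : KZ.of rd + KZ.of R = KZ.of r0 - (KZ.of r0 - KZ.of rd - KZ.of R) := by abel
      rw [this]; exact KZ.relations.sub_mem h0 h1
    have hre := KZ.of_sub_of_reindex_mem_relations r' e
    have : KZ.of (r'.reindex e) + KZ.of R = -(KZ.of r' - KZ.of (r'.reindex e)) - (KZ.of rb - KZ.of r') +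
        (KZ.of rb - KZ.of rd) + (KZ.of rd + KZ.of R) := by abel
    rw [this]
    exact KZ.relations.add_mem (KZ.relations.add_mem (KZ.relations.sub_mem
      (KZ.relations.neg_mem hre) hr'rel) hrel) hrdR

end Summit.KontsevichZagierPeriods.TerasomaMultiplication.MultiplicationAccessible

end
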